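import Summits.HubbardSuperconductivity.HubbardSuperconductivity.Theorems.WindowInfraredBound.Negative.NearGroundStates
import Summits.HubbardSuperconductivity.HubbardSuperconductivity.Theorems.BcsKacWindowInfraredCompletionSqrtShapeOfShapeBg

/-!
# Crux `InfraredCompletion` (stmt-HubbardSuperconductivity-1321, route BcsKacWindow), negative side:
# the ENERGY-WINDOW relaxation of the phase-coherence stub B3 (`stub_sqrtGoldstoneShape`) is FALSE
# given weak-coupling `d`-wave order

`not_sqrtShapeNearGroundStates_of_weakCouplingLRO` — the `stub_sqrtGoldstoneShape_false_without_GS`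
entry of this crux (line `birth`, skeleton v5, `Cruxes/InfraredCompletion/Lines/birth.lean`; proof due to
the crux strategist `planner-cstrat-stmt-HubbardSuperconductivity-1321-s1-0`, `Cruxes/InfraredCompletion/
WallSqrtShape.lean`, landed here verbatim with the relaxed statement INLINED so that no definition enters
the tree).

The refuted statement is the CONSEQUENT of the registered stub B3 — the pointwise sqrt-shape
`S_ψ(m)·|q_m|·L² ≤ A·L·√S_ψ(0) + D·Δ(U)·L² + B·|q_m|·L²` on the soft window `0 < |q_m| ≤ Δ(U)/t₀`, for
`δ ∈ [a,b]`, `U ∈ (0,U_R)`, even `L` with `t₀ ≤ Δ(U)·L` — with ONE change: the exact ground-state clause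
`IsGroundStateInSector` is relaxed to "unit vector of the `(N_L, 0)` sector with energy
`Re⟨ψ,Hψ⟩ ≤ minEnergyOn + 8π²`" (a FIXED, `L`-independent energy window above the ground energy).

HYPOTHESIS: at some doping `δ ∈ [a,b]` there are ARBITRARILY SMALL couplings `U` with `Δ(U) > 0` at which
the torus ground states carry `d`-wave pair LRO along the even sides (for all large even `L` SOME
normalised sector ground state has `‖Δ_dψ‖² ≥ a₀L⁴`) — the route's own regime, the conclusion of the crux
itself. WITNESS: the Lieb–Schultz–Mattis twist `G_jψ` of an ordered ground state
(`exists_twist_energy_le`: energy `≤ E₀ + 8π²`; `re_pairFieldAt_twist_ge`: it carries the condensate to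
`|q| = 4π/L`, `S_{Gψ}(∓2ê₁) ≥ a₀L²/2 − 32π²`), at which the sqrt-shape's left side is
`≥ (a₀L²/2 − 32π²)·4πL = Θ(L³)` while its right side is `≤ 6A·L² + DΔ(U)·L² + 4πB·L = O(L²)`
(`√S(0) ≤ √32·L < 6L` by the Parseval ceiling `pairStructureFactor_le_sumRule`).

READING (for line cards / `Disproof.lean` of this crux): stub B3 — like the sibling cruxes
`WindowInfraredBound` (stmt-1089, `…/WindowInfraredBound/Negative/NearGroundStates.lean`) and
`NoInfraredPileUp` (stmt-18534) — is a statement about EXACT eigenvectors at the bottom of the tower of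
states; any argument for B3 that is blind to `O(1)` TOTAL energy above the ground state (variational
closeness, approximate ground states, energy-DENSITY control of any precision, Kac/block energy
comparisons) is dead on arrival in the ordered regime. No parameter point is claimed (the LRO hypothesis is
the open input); the coherence-window hypothesis W of the crux is not used (the statement is W-free).
Support for the crux (`--supports stmt-HubbardSuperconductivity-1321`); no definitions, no named facts.
Sources: Lieb–Schultz–Mattis, Ann. Phys. 16 (1961) 407; H. Watanabe, J. Stat. Phys. 177 (2019) 717 §2.2.1;
Kennedy–Lieb–Shastry, PRL 61 (1988) 2582; Pitaevskii–Stringari, JLTP 85 (1991) 377. [folklore]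
-/

-- the mandated namespace `Summit.<Summit>.<Problem>.Theorems…` repeats `HubbardSuperconductivity`
-- (single-problem summit, D-0017), which the `dupNamespace` linter flags on every declaration
set_option linter.dupNamespace false

noncomputable section

namespace Summit.HubbardSuperconductivity.HubbardSuperconductivity.Theorems.InfraredCompletion.Negative

open Literature.MathematicalPhysics.QuantumLattice Literature.MathematicalPhysics.QuantumFieldTheory
  Literature.Probability.LatticeModels Matrix Finset
open Summit.HubbardSuperconductivity.HubbardSuperconductivity.Theorems
  (conjTranspose_phaseGauge_mulVec_phaseGauge_mulVec)
open Summit.HubbardSuperconductivity.HubbardSuperconductivity.Theorems.WindowInfraredBound.Negative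
open Summit.HubbardSuperconductivity.HubbardSuperconductivity.Theorems.InfraredCompletion
  (pairStructureFactor_le_sumRule)
open scoped Matrix.Norms.L2Operator ComplexOrder ComplexConjugate

/-- **With weak-coupling `d`-wave order, no `O(1)` energy window replaces the exact ground-state clause
of stub B3 (`stub_sqrtGoldstoneShape_false_without_GS`).** If at some doping `δ ∈ [a,b]`, for
arbitrarily small couplings `U` with `Δ(U) > 0`, every large even torus carries SOME normalised
`(2⌊(1−δ)L²/2⌋, 0)`-sector ground state `ψ_L` of `hubbardTorus 2 L 1 U` with `Re⟨Δ_dψ_L, Δ_dψ_L⟩ ≥ a₀L⁴`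
(`a₀ > 0`), then the consequent of stub B3 at the datum `(a, b, Δ)` with `IsGroundStateInSector` RELAXED
to "unit vector of the sector with `Re⟨ψ,Hψ⟩ ≤ minEnergyOn H (szSector N_L 0) + 8π²`" is FALSE: given
its `A, D, B, t₀, U_R`, pick such a `U < U_R`, an even `L ≥ max L₁ (t₀/Δ(U)) (4πt₀/Δ(U)) X` with
`2πa₀X = 6A + DΔ(U) + 4πB + 128π³ + 2πa₀`; the twisted ground state `G_jψ_L` (`exists_twist_energy_le`)
is admissible (`phaseGauge_mulVec_mem_szSector`, isometry), the label `m₀ = −2jê₁` is a nonzero window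
momentum (`|q_{m₀}| = 4π/L ≤ Δ(U)/t₀`), and there `S(m₀)·|q_{m₀}|·L² ≥ (a₀L²/2 − 32π²)·4πL`
(`re_pairFieldAt_twist_ge`) exceeds `A·L·√S(0) + DΔ(U)L² + B|q_{m₀}|L² ≤ 6AL² + DΔ(U)L² + 4πBL`
(`pairStructureFactor_le_sumRule`). Lieb–Schultz–Mattis (1961); Watanabe (2019) §2.2.1;
Kennedy–Lieb–Shastry (1988). [folklore] -/
theorem not_sqrtShapeNearGroundStates_of_weakCouplingLRO {a b : ℝ} {Δ : ℝ → ℝ}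
    (hLRO : ∃ δ ∈ Set.Icc a b, ∀ U' : ℝ, 0 < U' → ∃ U ∈ Set.Ioo (0:ℝ) U', 0 < Δ U ∧
      ∃ a₀ : ℝ, 0 < a₀ ∧ ∃ L₁ : ℕ, ∀ (L : ℕ) [NeZero L], L₁ ≤ L → Even L →
        ∃ ψ : Fock (Orb (FermionTorus 2 L)), star ψ ⬝ᵥ ψ = 1 ∧
          IsGroundStateInSector (hubbardTorus 2 L 1 U) (2 * ⌊(1 - δ) * (L : ℝ) ^ 2 / 2⌋₊) 0 ψ ∧
          a₀ * (L : ℝ) ^ 4 ≤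
            (star (pairField dWaveFormFactor L *ᵥ ψ) ⬝ᵥ (pairField dWaveFormFactor L *ᵥ ψ)).re) :
    ¬ (∃ A D B t₀ UR : ℝ, 0 ≤ A ∧ 0 ≤ D ∧ 0 ≤ B ∧ 0 < t₀ ∧ 0 < UR ∧
        ∀ δ ∈ Set.Icc a b, ∀ U ∈ Set.Ioo (0:ℝ) UR, ∀ (L : ℕ) [NeZero L], Even L → t₀ ≤ Δ U * L →
          ∀ ψ : Fock (Orb (FermionTorus 2 L)), star ψ ⬝ᵥ ψ = 1 →
            ψ ∈ szSector (Λ := FermionTorus 2 L) (2 * ⌊(1 - δ) * (L : ℝ) ^ 2 / 2⌋₊) 0 →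
            (star ψ ⬝ᵥ (hubbardTorus 2 L 1 U *ᵥ ψ)).re ≤
              (hubbardTorus 2 L 1 U).minEnergyOn
                (szSector (Λ := FermionTorus 2 L) (2 * ⌊(1 - δ) * (L : ℝ) ^ 2 / 2⌋₊) 0) +
                  8 * Real.pi ^ 2 →
            ∀ m : Fin 2 → ZMod L, m ≠ 0 → momentumNormSq L m ≤ (Δ U / t₀) ^ 2 →
              pairStructureFactor dWaveFormFactor L ψ m * Real.sqrt (momentumNormSq L m) *
                  (L : ℝ) ^ 2 ≤
                A * (L : ℝ) * Real.sqrt (pairStructureFactor dWaveFormFactor L ψ 0) +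
                  D * Δ U * (L : ℝ) ^ 2 + B * Real.sqrt (momentumNormSq L m) * (L : ℝ) ^ 2) := by
  rintro ⟨A, D, B, t₀, UR, hA, hD, hB, ht₀, hUR, h⟩
  obtain ⟨δ, hδ, hU'⟩ := hLRO
  obtain ⟨U, hU, hΔ, a₀, ha₀, L₁, hGS⟩ := hU' UR hUR
  -- the threshold beyond which `Θ(L³)` beats `O(L²)`
  obtain ⟨X, hXdef⟩ : ∃ X : ℝ,
      X = (6 * A + D * Δ U + 4 * Real.pi * B + 128 * Real.pi ^ 3) / (2 * Real.pi * a₀) + 1 := ⟨_, rfl⟩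
  have hXpos : 0 < X := by rw [hXdef]; positivity
  -- the torus side
  obtain ⟨n, hndef⟩ : ∃ n : ℕ,
      n = L₁ + ⌈t₀ / Δ U⌉₊ + ⌈4 * Real.pi * t₀ / Δ U⌉₊ + ⌈X⌉₊ + 3 := ⟨_, rfl⟩
  obtain ⟨L, hLdef⟩ : ∃ L : ℕ, L = 2 * n := ⟨_, rfl⟩
  have hL6 : 6 ≤ L := by omega
  haveI : NeZero L := ⟨by omega⟩
  have hL₁ : L₁ ≤ L := by omega
  have hL3 : 3 ≤ L := by omega
  have hEven : Even L := ⟨n, by omega⟩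
  have hLr : (0 : ℝ) < L := by exact_mod_cast (show 0 < L by omega)
  have hL1r : (1 : ℝ) ≤ L := by exact_mod_cast (show 1 ≤ L by omega)
  have hnr : (n : ℝ) ≤ L := by exact_mod_cast (show n ≤ L by omega)
  have hn_ge : (⌈t₀ / Δ U⌉₊ : ℝ) + ⌈4 * Real.pi * t₀ / Δ U⌉₊ + ⌈X⌉₊ ≤ n := by
    rw [hndef]; push_cast
    linarith [show (0:ℝ) ≤ L₁ from Nat.cast_nonneg _]
  have hc1 : (0:ℝ) ≤ ⌈t₀ / Δ U⌉₊ := Nat.cast_nonneg _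
  have hc2 : (0:ℝ) ≤ ⌈4 * Real.pi * t₀ / Δ U⌉₊ := Nat.cast_nonneg _
  have hc3 : (0:ℝ) ≤ ⌈X⌉₊ := Nat.cast_nonneg _
  have htL : t₀ ≤ Δ U * L := by
    have h1 := Nat.le_ceil (t₀ / Δ U)
    have h2 : t₀ / Δ U ≤ L := by linarith
    rw [div_le_iff₀ hΔ] at h2
    linarith [mul_comm (L : ℝ) (Δ U)]
  have h4πt : 4 * Real.pi * t₀ / Δ U ≤ L := by
    have h1 := Nat.le_ceil (4 * Real.pi * t₀ / Δ U)
    linarith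
  have hXL : X ≤ L := by
    have h1 := Nat.le_ceil X
    linarith
  -- the ordered ground state and its twist
  obtain ⟨ψ, hψ1, hψGS, hψa⟩ := hGS L hL₁ hEven
  obtain ⟨j, hj, hjE⟩ := exists_twist_energy_le hL3 U hψ1
  have hGu : ∀ v, (phaseGauge fun u : FermionTorus 2 L => twistGauge L (j * (2 * Real.pi)) u.toTorusSite)ᴴ *ᵥ
      (phaseGauge (fun u : FermionTorus 2 L => twistGauge L (j * (2 * Real.pi)) u.toTorusSite) *ᵥ v) = v :=
    conjTranspose_phaseGauge_mulVec_phaseGauge_mulVec _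
  have hφ1 : star (phaseGauge (fun u : FermionTorus 2 L => twistGauge L (j * (2 * Real.pi)) u.toTorusSite) *ᵥ ψ) ⬝ᵥ
      (phaseGauge (fun u : FermionTorus 2 L => twistGauge L (j * (2 * Real.pi)) u.toTorusSite) *ᵥ ψ) = 1 := by
    rw [star_mulVec_dotProduct_self_of_unitary hGu, hψ1]
  have hφmem := phaseGauge_mulVec_mem_szSector
    (fun u : FermionTorus 2 L => twistGauge L (j * (2 * Real.pi)) u.toTorusSite) hψGS.1
  have hE0 : (star ψ ⬝ᵥ (hubbardTorus 2 L 1 U *ᵥ ψ)).re =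
      (hubbardTorus 2 L 1 U).minEnergyOn
        (szSector (Λ := FermionTorus 2 L) (2 * ⌊(1 - δ) * (L : ℝ) ^ 2 / 2⌋₊) 0) := by
    rw [hψGS.2.2, dotProduct_smul, hψ1, smul_eq_mul, mul_one, Complex.ofReal_re]
  have hφE : (star (phaseGauge (fun u : FermionTorus 2 L => twistGauge L (j * (2 * Real.pi)) u.toTorusSite) *ᵥ ψ) ⬝ᵥ
      (hubbardTorus 2 L 1 U *ᵥ
        (phaseGauge (fun u : FermionTorus 2 L => twistGauge L (j * (2 * Real.pi)) u.toTorusSite) *ᵥ ψ))).re ≤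
      (hubbardTorus 2 L 1 U).minEnergyOn
        (szSector (Λ := FermionTorus 2 L) (2 * ⌊(1 - δ) * (L : ℝ) ^ 2 / 2⌋₊) 0) + 8 * Real.pi ^ 2 := by
    rw [← hE0]; exact hjE
  -- the window momentum `m₀ = −2jê₁`, `|q_{m₀}| = 4π/L`
  obtain ⟨m₀, hm₀⟩ : ∃ m₀ : TorusSite 2 L, m₀ = -(Pi.single 0 (((2 * j : ℤ)) : ZMod L)) := ⟨_, rfl⟩
  have hm₀1 : m₀ 1 = 0 := by
    rw [hm₀, Pi.neg_apply, Pi.single_eq_of_ne (by decide : (1 : Fin 2) ≠ 0), neg_zero]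
  have hval : ((m₀ 0).valMinAbs : ℝ) ^ 2 = 4 := by
    have h2 : ((2 : ℕ) : ZMod L).valMinAbs = (2 : ℕ) := ZMod.valMinAbs_natCast_of_le_half (by omega)
    rcases hj with rfl | rfl
    · have hm : m₀ 0 = -((2 : ℕ) : ZMod L) := by
        rw [hm₀, Pi.neg_apply, Pi.single_eq_same]; push_cast; ring
      have hne : 2 * ((2 : ℕ) : ZMod L).val ≠ L := by
        rw [ZMod.val_natCast, Nat.mod_eq_of_lt (by omega)]; omega
      rw [hm, ZMod.valMinAbs_neg_of_ne_half hne, h2]; push_cast; norm_num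
    · have hm : m₀ 0 = ((2 : ℕ) : ZMod L) := by
        rw [hm₀, Pi.neg_apply, Pi.single_eq_same]; push_cast; ring
      rw [hm, h2]; push_cast; norm_num
  have hm₀ne : m₀ ≠ 0 := by
    intro h0
    have h2 : ((m₀ 0).valMinAbs : ℝ) ^ 2 = 0 := by
      rw [h0, Pi.zero_apply, ZMod.valMinAbs_zero]; norm_num
    linarith
  have hmns : momentumNormSq L m₀ = (4 * Real.pi / (L : ℝ)) ^ 2 := by
    rw [momentumNormSq_apply, Fin.sum_univ_two, hval, hm₀1, ZMod.valMinAbs_zero]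
    push_cast
    ring
  have hq : Real.sqrt (momentumNormSq L m₀) = 4 * Real.pi / (L : ℝ) := by
    rw [hmns, Real.sqrt_sq (by positivity)]
  have hnorm : momentumNormSq L m₀ ≤ (Δ U / t₀) ^ 2 := by
    rw [hmns]
    have h1 : 4 * Real.pi / (L : ℝ) ≤ Δ U / t₀ := by
      rw [div_le_div_iff₀ hLr ht₀]
      rw [div_le_iff₀ hΔ] at h4πt
      linarith [mul_comm (L : ℝ) (Δ U)]
    have h0 : 0 ≤ 4 * Real.pi / (L : ℝ) := by positivity
    nlinarith [mul_self_le_mul_self h0 h1]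
  -- the relaxed sqrt-shape applied to the twisted ground state at `m₀`
  have hmain := h δ hδ U hU L hEven htL _ hφ1 hφmem hφE m₀ hm₀ne hnorm
  rw [hq] at hmain
  -- `S_{Gψ}(m₀) ≥ a₀L²/2 − 32π²`
  have hS : a₀ * (L : ℝ) ^ 2 / 2 - 32 * Real.pi ^ 2 ≤ pairStructureFactor dWaveFormFactor L
      (phaseGauge (fun u : FermionTorus 2 L => twistGauge L (j * (2 * Real.pi)) u.toTorusSite) *ᵥ ψ) m₀ := by
    have h := re_pairFieldAt_twist_ge hL3 hj hψ1
    rw [← hm₀] at h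
    have hL2 : (0 : ℝ) < (L : ℝ) ^ 2 := by positivity
    rw [pairStructureFactor_apply, le_div_iff₀ hL2]
    have h' : a₀ * (L : ℝ) ^ 4 / 2 - 32 * Real.pi ^ 2 * (L : ℝ) ^ 2 ≤
        (star (pairField dWaveFormFactor L *ᵥ ψ) ⬝ᵥ (pairField dWaveFormFactor L *ᵥ ψ)).re / 2 -
          32 * Real.pi ^ 2 * (L : ℝ) ^ 2 := by linarith
    calc (a₀ * (L : ℝ) ^ 2 / 2 - 32 * Real.pi ^ 2) * (L : ℝ) ^ 2
        = a₀ * (L : ℝ) ^ 4 / 2 - 32 * Real.pi ^ 2 * (L : ℝ) ^ 2 := by ring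
      _ ≤ _ := h'.trans h
  -- `√S_{Gψ}(0) ≤ 6L` (Parseval ceiling `S ≤ 32L²`)
  have hsqrt0 : Real.sqrt (pairStructureFactor dWaveFormFactor L
      (phaseGauge (fun u : FermionTorus 2 L => twistGauge L (j * (2 * Real.pi)) u.toTorusSite) *ᵥ ψ) 0) ≤
      6 * (L : ℝ) := by
    have h32 := pairStructureFactor_le_sumRule L _ hφ1 (0 : TorusSite 2 L)
    have h36 : pairStructureFactor dWaveFormFactor L
        (phaseGauge (fun u : FermionTorus 2 L => twistGauge L (j * (2 * Real.pi)) u.toTorusSite) *ᵥ ψ) 0 ≤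
        (6 * (L : ℝ)) ^ 2 := by nlinarith
    calc Real.sqrt _ ≤ Real.sqrt ((6 * (L : ℝ)) ^ 2) := Real.sqrt_le_sqrt h36
      _ = 6 * (L : ℝ) := Real.sqrt_sq (by positivity)
  -- lower bound of the left side: `(a₀L²/2 − 32π²) · (4π/L) · L² = 2πa₀L³ − 128π³L`
  set S₀ := pairStructureFactor dWaveFormFactor L
      (phaseGauge (fun u : FermionTorus 2 L => twistGauge L (j * (2 * Real.pi)) u.toTorusSite) *ᵥ ψ) m₀ with hS₀
  set R₀ := Real.sqrt (pairStructureFactor dWaveFormFactor L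
      (phaseGauge (fun u : FermionTorus 2 L => twistGauge L (j * (2 * Real.pi)) u.toTorusSite) *ᵥ ψ) 0) with hR₀
  have hR₀nn : 0 ≤ R₀ := Real.sqrt_nonneg _
  have hL0 : (L : ℝ) ≠ 0 := hLr.ne'
  have hrewS : S₀ * (4 * Real.pi / (L : ℝ)) * (L : ℝ) ^ 2 = S₀ * (4 * Real.pi * L) := by
    field_simp
  have hrewB : B * (4 * Real.pi / (L : ℝ)) * (L : ℝ) ^ 2 = 4 * Real.pi * B * L := by
    field_simp
  -- lower bound of the left side: `(a₀L²/2 − 32π²) · 4πL ≤ S₀ · (4π/L) · L²`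
  have hlhs : (a₀ * (L : ℝ) ^ 2 / 2 - 32 * Real.pi ^ 2) * (4 * Real.pi * L) ≤
      S₀ * (4 * Real.pi / (L : ℝ)) * (L : ℝ) ^ 2 := by
    rw [hrewS]
    exact mul_le_mul_of_nonneg_right hS (by positivity)
  -- upper bound of the right side: `≤ 6A·L² + DΔ(U)·L² + 4πB·L`
  have hrhs : A * (L : ℝ) * R₀ + D * Δ U * (L : ℝ) ^ 2 + B * (4 * Real.pi / (L : ℝ)) * (L : ℝ) ^ 2 ≤
      6 * A * (L : ℝ) ^ 2 + D * Δ U * (L : ℝ) ^ 2 + 4 * Real.pi * B * L := by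
    have h1 : A * (L : ℝ) * R₀ ≤ A * (L : ℝ) * (6 * L) :=
      mul_le_mul_of_nonneg_left hsqrt0 (by positivity)
    rw [hrewB]
    linarith
  -- the threshold: `2πa₀·L ≥ 6A + DΔ(U) + 4πB + 128π³ + 2πa₀`
  have hthr : 6 * A + D * Δ U + 4 * Real.pi * B + 128 * Real.pi ^ 3 + 2 * Real.pi * a₀ ≤
      2 * Real.pi * a₀ * L := by
    have h1 : 2 * Real.pi * a₀ * X ≤ 2 * Real.pi * a₀ * L :=
      mul_le_mul_of_nonneg_left hXL (by positivity)
    have h2 : 2 * Real.pi * a₀ * X =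
        6 * A + D * Δ U + 4 * Real.pi * B + 128 * Real.pi ^ 3 + 2 * Real.pi * a₀ := by
      rw [hXdef]; field_simp
    linarith
  have hL2nn : (0 : ℝ) ≤ (L : ℝ) ^ 2 := by positivity
  have hthr2 : (6 * A + D * Δ U + 4 * Real.pi * B + 128 * Real.pi ^ 3 + 2 * Real.pi * a₀) * (L : ℝ) ^ 2 ≤
      2 * Real.pi * a₀ * L * (L : ℝ) ^ 2 := mul_le_mul_of_nonneg_right hthr hL2nn
  have hLL : (L : ℝ) ≤ (L : ℝ) ^ 2 := by
    have hmul := mul_le_mul_of_nonneg_left hL1r hLr.le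
    rw [mul_one] at hmul
    simpa [sq] using hmul
  have hBπ : 0 ≤ 4 * Real.pi * B + 128 * Real.pi ^ 3 := by positivity
  have hlow2 : (4 * Real.pi * B + 128 * Real.pi ^ 3) * (L : ℝ) ≤
      (4 * Real.pi * B + 128 * Real.pi ^ 3) * (L : ℝ) ^ 2 := mul_le_mul_of_nonneg_left hLL hBπ
  have hpos : 0 < 2 * Real.pi * a₀ * (L : ℝ) ^ 2 := by positivity
  linarith [hlhs, hrhs, hmain, hthr2, hlow2, hpos]

end Summit.HubbardSuperconductivity.HubbardSuperconductivity.Theorems.InfraredCompletion.Negative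

end
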